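import Mathlib.Analysis.SpecialFunctions.Complex.Analytic
import Mathlib.Analysis.SpecialFunctions.Complex.Arg
import Mathlib.Analysis.Analytic.Uniqueness
import Mathlib.Analysis.Real.Pi.Bounds
import HarnessLib

/-!
# No analytic continuation from the two-slot cross to a doubly-boosted point — stub `stub_twoSlotEnvelopeObstruction`

Line `complex-rotation-bandlimit` of crux `PencilRigidity.NPointIsotropy` (stmt-QuantumFields-11686),
registered side stub (pure several complex variables, model-blind) of the skeleton
`Cruxes/NPointIsotropy/Lines/complex_rotation_bandlimit.lean`.

Statement (`stub_twoSlotEnvelopeObstruction`, registered signature verbatim).  In light-cone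
coordinates a slot is a pair `(u, v) ∈ ℂ₊ × ℂ₊` (`ℂ₊` the open right half-plane), the Euclidean
configurations form the totally real slice `{v = conj u}`, and a boost of rapidity `χ` acts by
`(u, v) ↦ (e^{-χ} u, e^{χ} v)`.  For TWO slots let `Ω := (ℂ₊ × ℂ₊)²` and let the CROSS `X ⊆ Ω` be the
set of configurations with at least one slot on its real slice.  For every `w : Fin 2 → ℂ₊` and every
`χ ≥ 3` there are an open `U` with `X ⊆ U ⊆ Ω` and a holomorphic `f` on `U` such that NO preconnected
open `E` with `X ⊆ E ⊆ Ω` containing the doubly-boosted point `P_χ = (e^{-χ} w_j, e^{χ} conj w_j)_j`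
carries an analytic `G` agreeing with `f` on `U ∩ E`.

Proof.  Put `L_j z := log v_j - log u_j` (principal branch) and `g := L₀ · L₁`, analytic on the open
set `Ω` (each coordinate lies in the slit plane).  On `ℂ₊`, `|arg| < π / 2`
(`Complex.abs_arg_lt_pi_div_two_iff`), so `|Im L_j| < π` on `Ω`.  On the cross one factor has
`Re L_i = log ‖conj u_i‖ - log ‖u_i‖ = 0`, whence `Re g = -Im L₀ · Im L₁ < π²` there.  At `P_χ`,
`Re L_j = (χ + log ‖w_j‖) - (-χ + log ‖w_j‖) = 2χ`, so `Re g(P_χ) = 4χ² - Im L₀ Im L₁ > 36 - π² > π²`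
(`π < 4`).  With `c := g(P_χ)` take `U := {z ∈ Ω | Re g z < Re c} ⊇ X` and `f := (g - c)⁻¹`,
holomorphic on `U`.  If `G` is analytic on a preconnected open `E ⊇ X ∪ {P_χ}`, `E ⊆ Ω`, with `G = f`
on `U ∩ E`, then `h := (g - c) · G - 1` is analytic on `E` and vanishes on the nonempty open set
`U ∩ E ∋ ((1, 1), (1, 1))`, hence on all of `E` by the identity theorem
(`AnalyticOnNhd.eqOn_zero_of_preconnected_of_eventuallyEq_zero`); but `h(P_χ) = -1`.

References: L. Hörmander, *An introduction to complex analysis in several variables*, 3rd ed.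
(North-Holland, 1990), §2.5 (domains of holomorphy; sublevel sets of real parts of holomorphic
functions as obstructions); R. F. Streater, A. S. Wightman, *PCT, spin and statistics, and all that*
(Benjamin, 1964), §2-5 (extended tubes, boosted points). [folklore]
-/

noncomputable section

namespace Summit.QuantumFields.YangMills.Theorems.NPointIsotropy.ComplexRotationBandlimit

open Filter Topology

namespace TwoSlotEnvelopeObstruction

/-! ## Scalar estimates for the slot logarithm `log v - log u` -/

/-- For `u, v` in the open right half-plane, `|Im (log v - log u)| = |arg v - arg u| < π`
(`|arg| < π / 2` on the right half-plane). [folklore] -/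
theorem abs_im_log_sub_log_lt {u v : ℂ} (hu : 0 < u.re) (hv : 0 < v.re) :
    |(Complex.log v - Complex.log u).im| < Real.pi := by
  have h1 := abs_lt.1 (Complex.abs_arg_lt_pi_div_two_iff.2 (Or.inl hu))
  have h2 := abs_lt.1 (Complex.abs_arg_lt_pi_div_two_iff.2 (Or.inl hv))
  rw [Complex.sub_im, Complex.log_im, Complex.log_im, abs_lt]
  constructor <;> linarith [h1.1, h1.2, h2.1, h2.2]

/-- On the real slice `v = conj u` the slot logarithm is purely imaginary:
`Re (log (conj u) - log u) = log ‖conj u‖ - log ‖u‖ = 0`. [folklore] -/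
theorem re_log_conj_sub_log (u : ℂ) : (Complex.log (starRingEnd ℂ u) - Complex.log u).re = 0 := by
  rw [Complex.sub_re, Complex.log_re, Complex.log_re, Complex.norm_conj, sub_self]

/-- If `|Im a|, |Im b| < π` then `|Im a · Im b| < π²`. [folklore] -/
theorem abs_im_mul_im_lt {a b : ℂ} (ha : |a.im| < Real.pi) (hb : |b.im| < Real.pi) :
    |a.im * b.im| < Real.pi ^ 2 := by
  rw [abs_mul, sq]
  exact mul_lt_mul'' ha hb (abs_nonneg _) (abs_nonneg _)

/-- If `|Im a|, |Im b| < π` and one of `Re a`, `Re b` vanishes, then `Re (a b) = -Im a · Im b < π²`.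
[folklore] -/
theorem re_mul_lt_pi_sq {a b : ℂ} (ha : |a.im| < Real.pi) (hb : |b.im| < Real.pi)
    (h : a.re = 0 ∨ b.re = 0) : (a * b).re < Real.pi ^ 2 := by
  rw [Complex.mul_re, mul_eq_zero.2 h, zero_sub]
  exact (neg_le_abs _).trans_lt (abs_im_mul_im_lt ha hb)

/-- If `|Im a|, |Im b| < π` and `Re a = Re b = 2χ` with `χ ≥ 3`, then
`Re (a b) = 4χ² - Im a · Im b > 36 - π² > π²` (`π < 4`). [folklore] -/
theorem pi_sq_lt_re_mul {a b : ℂ} {χ : ℝ} (hχ : 3 ≤ χ) (ha : |a.im| < Real.pi)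
    (hb : |b.im| < Real.pi) (hra : a.re = 2 * χ) (hrb : b.re = 2 * χ) :
    Real.pi ^ 2 < (a * b).re := by
  have hIm := (le_abs_self _).trans_lt (abs_im_mul_im_lt ha hb)
  have hπ : Real.pi ^ 2 < 16 := by nlinarith [Real.pi_lt_four, Real.pi_pos]
  have hχ2 : (36 : ℝ) ≤ 2 * χ * (2 * χ) := by nlinarith
  rw [Complex.mul_re, hra, hrb]
  linarith

/-! ## The doubly-boosted slot `(e^{-χ} w, e^{χ} conj w)` -/

/-- A doubly-boosted slot stays in `ℂ₊ × ℂ₊`: `Re (e^{-χ} w) = e^{-χ} Re w > 0` and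
`Re (e^{χ} conj w) = e^{χ} Re w > 0`. [folklore] -/
theorem re_boost_pos {w : ℂ} (hw : 0 < w.re) (χ : ℝ) :
    0 < (((Real.exp (-χ) : ℝ) : ℂ) * w).re ∧ 0 < (((Real.exp χ : ℝ) : ℂ) * starRingEnd ℂ w).re := by
  rw [Complex.re_ofReal_mul, Complex.re_ofReal_mul, Complex.conj_re]
  exact ⟨mul_pos (Real.exp_pos _) hw, mul_pos (Real.exp_pos _) hw⟩

/-- At a doubly-boosted slot the slot logarithm has real part
`Re (log (e^{χ} conj w) - log (e^{-χ} w)) = (χ + log ‖w‖) - (-χ + log ‖w‖) = 2χ`. [folklore] -/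
theorem re_log_boost_sub {w : ℂ} (hw : 0 < w.re) (χ : ℝ) :
    (Complex.log (((Real.exp χ : ℝ) : ℂ) * starRingEnd ℂ w) -
      Complex.log (((Real.exp (-χ) : ℝ) : ℂ) * w)).re = 2 * χ := by
  have hw0 : ‖w‖ ≠ 0 := by
    refine norm_ne_zero_iff.2 fun h => hw.ne' ?_
    rw [h, Complex.zero_re]
  rw [Complex.sub_re, Complex.log_re, Complex.log_re, norm_mul, norm_mul, Complex.norm_conj,
    Complex.norm_real, Complex.norm_real, Real.norm_eq_abs, Real.norm_eq_abs, Real.abs_exp,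
    Real.abs_exp, Real.log_mul (Real.exp_pos _).ne' hw0, Real.log_mul (Real.exp_pos _).ne' hw0,
    Real.log_exp, Real.log_exp]
  ring

/-! ## The test function `g = (log v₀ - log u₀)(log v₁ - log u₁)` on `Ω = (ℂ₊ × ℂ₊)²` -/

/-- The coordinate `z ↦ u_j` is analytic (a continuous linear map). [folklore] -/
theorem analyticAt_fst_apply (j : Fin 2) (z : Fin 2 → ℂ × ℂ) :
    AnalyticAt ℂ (fun z : Fin 2 → ℂ × ℂ => (z j).1) z :=
  ((ContinuousLinearMap.fst ℂ ℂ ℂ).comp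
    (ContinuousLinearMap.proj (R := ℂ) (φ := fun _ : Fin 2 => ℂ × ℂ) j)).analyticAt z

/-- The coordinate `z ↦ v_j` is analytic (a continuous linear map). [folklore] -/
theorem analyticAt_snd_apply (j : Fin 2) (z : Fin 2 → ℂ × ℂ) :
    AnalyticAt ℂ (fun z : Fin 2 → ℂ × ℂ => (z j).2) z :=
  ((ContinuousLinearMap.snd ℂ ℂ ℂ).comp
    (ContinuousLinearMap.proj (R := ℂ) (φ := fun _ : Fin 2 => ℂ × ℂ) j)).analyticAt z

/-- The slot logarithm `z ↦ log v_j - log u_j` is analytic at every configuration whose slot `j`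
lies in `ℂ₊ × ℂ₊` (both coordinates are in the slit plane). [folklore] -/
theorem analyticAt_log_sub_log (j : Fin 2) {z : Fin 2 → ℂ × ℂ} (hu : 0 < (z j).1.re)
    (hv : 0 < (z j).2.re) :
    AnalyticAt ℂ (fun z : Fin 2 → ℂ × ℂ => Complex.log (z j).2 - Complex.log (z j).1) z :=
  ((analyticAt_snd_apply j z).clog (Complex.mem_slitPlane_iff.2 (Or.inl hv))).fun_sub
    ((analyticAt_fst_apply j z).clog (Complex.mem_slitPlane_iff.2 (Or.inl hu)))

/-- `g = (log v₀ - log u₀)(log v₁ - log u₁)` is analytic at every point of `Ω`. [folklore] -/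
theorem analyticAt_logProd {z : Fin 2 → ℂ × ℂ} (hz : ∀ j, 0 < (z j).1.re ∧ 0 < (z j).2.re) :
    AnalyticAt ℂ (fun z : Fin 2 → ℂ × ℂ =>
      (Complex.log (z 0).2 - Complex.log (z 0).1) * (Complex.log (z 1).2 - Complex.log (z 1).1)) z :=
  (analyticAt_log_sub_log 0 (hz 0).1 (hz 0).2).fun_mul (analyticAt_log_sub_log 1 (hz 1).1 (hz 1).2)

/-- On the cross (one slot on its real slice) `Re g < π²`. [folklore] -/
theorem re_logProd_lt_of_mem_cross {z : Fin 2 → ℂ × ℂ} (hz : ∀ j, 0 < (z j).1.re ∧ 0 < (z j).2.re)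
    (hX : ∃ j, ∀ i, i ≠ j → (z i).2 = starRingEnd ℂ (z i).1) :
    ((Complex.log (z 0).2 - Complex.log (z 0).1) *
      (Complex.log (z 1).2 - Complex.log (z 1).1)).re < Real.pi ^ 2 := by
  obtain ⟨j, hj⟩ := hX
  refine re_mul_lt_pi_sq (abs_im_log_sub_log_lt (hz 0).1 (hz 0).2)
    (abs_im_log_sub_log_lt (hz 1).1 (hz 1).2) ?_
  fin_cases j
  · refine Or.inr ?_
    rw [hj 1 (by decide)]
    exact re_log_conj_sub_log _
  · refine Or.inl ?_
    rw [hj 0 (by decide)]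
    exact re_log_conj_sub_log _

/-- At the doubly-boosted point `P_χ` (`χ ≥ 3`), `Re g(P_χ) > π²`. [folklore] -/
theorem pi_sq_lt_re_logProd_boost {w : Fin 2 → ℂ} (hw : ∀ j, 0 < (w j).re) {χ : ℝ} (hχ : 3 ≤ χ) :
    Real.pi ^ 2 <
      ((Complex.log (((Real.exp χ : ℝ) : ℂ) * starRingEnd ℂ (w 0)) -
          Complex.log (((Real.exp (-χ) : ℝ) : ℂ) * w 0)) *
        (Complex.log (((Real.exp χ : ℝ) : ℂ) * starRingEnd ℂ (w 1)) -
          Complex.log (((Real.exp (-χ) : ℝ) : ℂ) * w 1))).re :=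
  pi_sq_lt_re_mul hχ
    (abs_im_log_sub_log_lt (re_boost_pos (hw 0) χ).1 (re_boost_pos (hw 0) χ).2)
    (abs_im_log_sub_log_lt (re_boost_pos (hw 1) χ).1 (re_boost_pos (hw 1) χ).2)
    (re_log_boost_sub (hw 0) χ) (re_log_boost_sub (hw 1) χ)

/-- `Ω = (ℂ₊ × ℂ₊)²` is open: finitely many open half-space conditions. [folklore] -/
theorem isOpen_twoSlotDomain :
    IsOpen {z : Fin 2 → ℂ × ℂ | ∀ j, 0 < (z j).1.re ∧ 0 < (z j).2.re} := by
  simp only [Set.setOf_forall]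
  refine isOpen_iInter_of_finite fun j => IsOpen.and ?_ ?_
  · exact isOpen_lt continuous_const
      (Complex.continuous_re.comp (continuous_fst.comp (continuous_apply j)))
  · exact isOpen_lt continuous_const
      (Complex.continuous_re.comp (continuous_snd.comp (continuous_apply j)))

/-- The base point `((1, 1), (1, 1))` lies on the cross. [folklore] -/
theorem one_mem_cross :
    (fun _ : Fin 2 => ((1 : ℂ), (1 : ℂ))) ∈
      {z : Fin 2 → ℂ × ℂ | (∀ j, 0 < (z j).1.re ∧ 0 < (z j).2.re) ∧
        ∃ j, ∀ i, i ≠ j → (z i).2 = starRingEnd ℂ (z i).1} :=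
  ⟨fun _ => ⟨by simp, by simp⟩, ⟨0, fun _ _ => (map_one (starRingEnd ℂ)).symm⟩⟩

end TwoSlotEnvelopeObstruction

open TwoSlotEnvelopeObstruction in
/-- **Registered side stub — NO ANALYTIC CONTINUATION FROM THE TWO-SLOT CROSS TO A DOUBLY-BOOSTED
POINT (skeleton `Cruxes/NPointIsotropy/Lines/complex_rotation_bandlimit.lean`, signature verbatim).**
For `w : Fin 2 → ℂ₊` and `χ ≥ 3`, with `g = (log v₀ - log u₀)(log v₁ - log u₁)` and `c = g(P_χ)`,
the open set `U = {z ∈ Ω | Re g z < Re c}` contains the cross `X` (`Re g < π²` on `X`,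
`Re c > 36 - π² > π²`) and `f = (g - c)⁻¹` is holomorphic on `U`; an analytic `G` on a preconnected
open `E`, `X ∪ {P_χ} ⊆ E ⊆ Ω`, agreeing with `f` on `U ∩ E` would make `(g - c) G - 1` vanish
identically on `E` (identity theorem from the nonempty open set `U ∩ E`), yet it equals `-1` at
`P_χ`. [folklore] -/
theorem stub_twoSlotEnvelopeObstruction :
    ∀ (w : Fin 2 → ℂ), (∀ j, 0 < (w j).re) → ∀ χ : ℝ, 3 ≤ χ →
      ∃ (U : Set (Fin 2 → ℂ × ℂ)) (f : (Fin 2 → ℂ × ℂ) → ℂ), IsOpen U ∧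
        {z : Fin 2 → ℂ × ℂ | (∀ j, 0 < (z j).1.re ∧ 0 < (z j).2.re) ∧
          ∃ j, ∀ i, i ≠ j → (z i).2 = starRingEnd ℂ (z i).1} ⊆ U ∧
        U ⊆ {z : Fin 2 → ℂ × ℂ | ∀ j, 0 < (z j).1.re ∧ 0 < (z j).2.re} ∧
        DifferentiableOn ℂ f U ∧
        ∀ E : Set (Fin 2 → ℂ × ℂ), IsOpen E → IsPreconnected E →
          {z : Fin 2 → ℂ × ℂ | (∀ j, 0 < (z j).1.re ∧ 0 < (z j).2.re) ∧
            ∃ j, ∀ i, i ≠ j → (z i).2 = starRingEnd ℂ (z i).1} ⊆ E →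
          (fun j => (((Real.exp (-χ) : ℝ) : ℂ) * w j, ((Real.exp χ : ℝ) : ℂ) * starRingEnd ℂ (w j))) ∈ E →
          E ⊆ {z : Fin 2 → ℂ × ℂ | ∀ j, 0 < (z j).1.re ∧ 0 < (z j).2.re} →
          ∀ G : (Fin 2 → ℂ × ℂ) → ℂ, AnalyticOnNhd ℂ G E → Set.EqOn G f (U ∩ E) → False := by
  intro w hw χ hχ
  -- the test function `g = (log v₀ - log u₀)(log v₁ - log u₁)` and the doubly-boosted point `P_χ`
  obtain ⟨g, hg⟩ : ∃ g : (Fin 2 → ℂ × ℂ) → ℂ, g = fun z =>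
      (Complex.log (z 0).2 - Complex.log (z 0).1) * (Complex.log (z 1).2 - Complex.log (z 1).1) :=
    ⟨_, rfl⟩
  set Pt : Fin 2 → ℂ × ℂ := fun j =>
    (((Real.exp (-χ) : ℝ) : ℂ) * w j, ((Real.exp χ : ℝ) : ℂ) * starRingEnd ℂ (w j)) with hPt
  have hga : AnalyticOnNhd ℂ g {z : Fin 2 → ℂ × ℂ | ∀ j, 0 < (z j).1.re ∧ 0 < (z j).2.re} := by
    rw [hg]
    exact fun z hz => analyticAt_logProd hz
  have hgX : ∀ z ∈ {z : Fin 2 → ℂ × ℂ | (∀ j, 0 < (z j).1.re ∧ 0 < (z j).2.re) ∧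
      ∃ j, ∀ i, i ≠ j → (z i).2 = starRingEnd ℂ (z i).1}, (g z).re < Real.pi ^ 2 := by
    rw [hg]
    exact fun z hz => re_logProd_lt_of_mem_cross hz.1 hz.2
  have hgP : Real.pi ^ 2 < (g Pt).re := by
    rw [hg]
    exact pi_sq_lt_re_logProd_boost hw hχ
  -- the level `c = g(P_χ)`, the sublevel set `U = {z ∈ Ω | Re g z < Re c}` and `f = (g - c)⁻¹`
  set c : ℂ := g Pt with hc
  have hUo : IsOpen ({z : Fin 2 → ℂ × ℂ | ∀ j, 0 < (z j).1.re ∧ 0 < (z j).2.re} ∩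
      (fun z => (g z).re) ⁻¹' Set.Iio c.re) :=
    (Complex.continuous_re.comp_continuousOn' hga.continuousOn).isOpen_inter_preimage
      isOpen_twoSlotDomain isOpen_Iio
  have hXU : {z : Fin 2 → ℂ × ℂ | (∀ j, 0 < (z j).1.re ∧ 0 < (z j).2.re) ∧
      ∃ j, ∀ i, i ≠ j → (z i).2 = starRingEnd ℂ (z i).1} ⊆
        {z : Fin 2 → ℂ × ℂ | ∀ j, 0 < (z j).1.re ∧ 0 < (z j).2.re} ∩
          (fun z => (g z).re) ⁻¹' Set.Iio c.re :=
    fun z hz => ⟨hz.1, (hgX z hz).trans hgP⟩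
  have hne : ∀ z ∈ {z : Fin 2 → ℂ × ℂ | ∀ j, 0 < (z j).1.re ∧ 0 < (z j).2.re} ∩
      (fun z => (g z).re) ⁻¹' Set.Iio c.re, g z - c ≠ 0 := fun z hz h => by
    have hlt : (g z).re < c.re := hz.2
    rw [sub_eq_zero.1 h] at hlt
    exact lt_irrefl _ hlt
  have hf : AnalyticOnNhd ℂ (fun z => (g z - c)⁻¹)
      ({z : Fin 2 → ℂ × ℂ | ∀ j, 0 < (z j).1.re ∧ 0 < (z j).2.re} ∩
        (fun z => (g z).re) ⁻¹' Set.Iio c.re) :=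
    fun z hz => ((hga z hz.1).fun_sub analyticAt_const).fun_inv (hne z hz)
  refine ⟨{z : Fin 2 → ℂ × ℂ | ∀ j, 0 < (z j).1.re ∧ 0 < (z j).2.re} ∩
      (fun z => (g z).re) ⁻¹' Set.Iio c.re, fun z => (g z - c)⁻¹, hUo, hXU, fun z hz => hz.1,
    hf.differentiableOn, ?_⟩
  intro E hE hEc hXE hPE hEΩ G hG hGf
  change Pt ∈ E at hPE
  -- `h = (g - c) G - 1` is analytic on `E` and vanishes on the nonempty open set `U ∩ E`
  have hh : AnalyticOnNhd ℂ (fun z => (g z - c) * G z - 1) E := fun z hz =>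
    (((hga z (hEΩ hz)).fun_sub analyticAt_const).fun_mul (hG z hz)).fun_sub analyticAt_const
  have h0U := hXU one_mem_cross
  have h0E := hXE one_mem_cross
  have hev : (fun z => (g z - c) * G z - 1) =ᶠ[𝓝 (fun _ : Fin 2 => ((1 : ℂ), (1 : ℂ)))] 0 := by
    refine Filter.eventuallyEq_of_mem ((hUo.inter hE).mem_nhds ⟨h0U, h0E⟩) fun z hz => ?_
    rw [hGf hz, Pi.zero_apply, mul_inv_cancel₀ (hne z hz.1), sub_self]
  -- hence `h = 0` on `E` by the identity theorem; but `h(P_χ) = -1`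
  have hP0 := hh.eqOn_zero_of_preconnected_of_eventuallyEq_zero hEc h0E hev hPE
  simp only [Pi.zero_apply, hc, sub_self, zero_mul, zero_sub, neg_eq_zero, one_ne_zero] at hP0

end Summit.QuantumFields.YangMills.Theorems.NPointIsotropy.ComplexRotationBandlimit

end
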